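import Literature.Geometry.Symplectic.SteinTwoHandles
import Literature.Geometry.Symplectic.SteinFillingSphere
import Literature.Topology.FourManifolds.HomotopySpheres
import Literature.Topology.FourManifolds.TwistedSpheres
import Literature.Topology.FourManifolds.SchoenfliesTools
import Literature.Topology.FourManifolds.AkbulutKirbyCerfReduction
import Literature.Topology.FourManifolds.Cobordism
import Literature.Geometry.Manifold.EmbeddingRangeDiffeomorph
import Literature.Topology.FourManifolds.ClosedBall
import Literature.Topology.FourManifolds.ClosedBallSmoothEmbeddings
import HarnessLib

/-!
# Stub `stub_certifiedFakeBallStandard` of line `bennequin-defect-certificates` for crux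
`OrigamiFoldExistence` (item stmt-SmoothPoincare4-7844, route route-SmoothPoincare4-SymplecticOrigami)

The registered stub, VERBATIM (skeleton
`Cruxes/OrigamiFoldExistence/Lines/bennequin_defect_certificates.lean`): **certified fake ball ⇒
standard.**  Under the three antecedents it takes as hypotheses —

* **E2** = `Literature.Geometry.Symplectic.Gompf1998_thm13_twoHandles` (Eliashberg's theorem, part
  II: a Stein structure extends over 2-handles attached along Legendrian knots with framing
  `tb - 1`; Gompf 1998 Thm. 1.3, Akbulut–Matveyev 1998 §3),
* **EL** = `Literature.Geometry.Symplectic.Eliashberg1990_steinFilling_sphere_three` (every Stein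
  filling of `S³` is `𝔻⁴`; Eliashberg 1990 Thm. 5.1),
* **Cerf `Γ₄ = 0`** in twisted-sphere form (the body of the route item `CerfGammaFour` = the named
  fact `Literature.Topology.FourManifolds.cerf_twistedSphere_four`),

a homotopy 4-sphere `S` whose fake ball `Δ = S ∖ e(B̊⁴)` (typed extrinsically: `e : ℝ⁴ ↪ S` and
`j : Δ ↪ S` smooth embeddings, `range j = (e B̊⁴)ᶜ`, `j(∂Δ) = e(S³)`) is `W₀ ∪` finitely many
2-handles attached along `T`-Legendrian knots of twisting `-1`, for a Stein structure `T` on the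
compact 4-manifold `W₀`, is diffeomorphic to `S⁴`.

Proof (all ingredients are proved tree theorems; the antecedents enter only as hypotheses).
(1) E2 makes `Δ` a Stein domain.  (2) `∂Δ ≅ S³`: the boundary datum `b` of `Δ`
(`nonempty_boundaryData_holds`) composed with `j` is a smooth embedding `b.carrier ↪ S`
(`isSmoothEmbedding_comp_boundaryData_incl`) with range `j(∂Δ) = e(S³)`, the range of the smooth
embedding `e|S³` (`isSmoothEmbedding_comp_coe_sphere`); two embeddings with the same range have
diffeomorphic sources (`Literature.Geometry.Manifold.exists_diffeomorph_comp_eq_of_range_eq`).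
(3) EL gives `Ψ : Δ ≅ 𝔻⁴`.  (4) `j ∘ Ψ⁻¹` and `e|𝔻⁴` are two smooth closed-disc embeddings
covering `S`, meeting only in boundary points (`range j ∩ e(B̊⁴) = ∅`, `Diffeomorph.preimage_boundary`,
`boundary_closedBall`) with the common boundary sphere `e(S³)`, so `S = 𝔻⁴ ∪_φ 𝔻⁴`
(`SchoenfliesTools.exists_isTwistedSphere`).  (5) The Cerf antecedent applied to `S` bundled as a
`TwistedSphere 3 φ`.

Everything here is proved; no definitions, no named facts.

References: R. E. Gompf, *Handlebody construction of Stein surfaces*, Ann. of Math. 148 (1998),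
Thm. 1.3 [Gompf1998]; S. Akbulut, R. Matveyev, *A convex decomposition theorem for 4-manifolds*,
IMRN 1998, §3 [AkbulutMatveyev1998]; Ya. Eliashberg, *Filling by holomorphic discs and its
applications* (1990), Thm. 5.1 [Eliashberg1990]; J. Cerf, *Sur les difféomorphismes de la sphère de
dimension trois (Γ₄ = 0)*, LNM 53 (1968) [CerfDiffeoSphere1968]; M. Kervaire, J. Milnor, *Groups
of homotopy spheres I*, Ann. Math. 77 (1963), §1 [KervaireMilnor1963]; J. Milnor, *Lectures on the
h-cobordism theorem* (1965), §9 [Milnor1965]; J. M. Lee, *Introduction to Smooth Manifolds* (2013),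
Thm. 5.31.
-/

noncomputable section

-- the prescribed namespace `Summit.<P>.<Sub>.…` duplicates `SmoothPoincare4` (P = Sub)
set_option linter.dupNamespace false

open scoped Manifold ContDiff Topology
open Set Function Metric

namespace Summit.SmoothPoincare4.SmoothPoincare4.Theorems.OrigamiFoldExistence.BennequinDefectCertificates

/-- **A chart ball restricted to the unit sphere is a smooth embedding `S³ ↪ M`.**  If
`e : ℝ⁴ → M` is a smooth embedding into a Hausdorff smooth 4-manifold, then `e ∘ Subtype.val` on
the round unit sphere `S³ ⊂ ℝ⁴` (Mathlib's stereographic structure, model `𝓡 3`) is a smooth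
embedding: smooth (`contMDiff_coe_sphere`), injective, with injective differential by the chain
rule (`mfderiv_coe_sphere_injective` and the injectivity of the differential of the immersion
`e`), on a compact source (`isSmoothEmbedding_of_injective_of_injective_mfderiv`). -/
theorem isSmoothEmbedding_comp_coe_sphere {M : Type*} [TopologicalSpace M] [T2Space M]
    [ChartedSpace (EuclideanSpace ℝ (Fin 4)) M] [IsManifold (𝓡 4) ∞ M]
    {e : EuclideanSpace ℝ (Fin 4) → M} (he : Manifold.IsSmoothEmbedding (𝓡 4) (𝓡 4) ∞ e) :
    Manifold.IsSmoothEmbedding (𝓡 3) (𝓡 4) ∞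
      (e ∘ Subtype.val : Metric.sphere (0 : EuclideanSpace ℝ (Fin 4)) 1 → M) := by
  haveI : Fact (Module.finrank ℝ (EuclideanSpace ℝ (Fin 4)) = 3 + 1) := ⟨finrank_euclideanSpace_fin⟩
  have hc : ContMDiff (𝓡 3) (𝓡 4) ∞
      (e ∘ Subtype.val : Metric.sphere (0 : EuclideanSpace ℝ (Fin 4)) 1 → M) :=
    he.contMDiff.comp contMDiff_coe_sphere
  have hinj : Injective (e ∘ Subtype.val : Metric.sphere (0 : EuclideanSpace ℝ (Fin 4)) 1 → M) :=
    he.isEmbedding.injective.comp Subtype.val_injective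
  refine Literature.Topology.FourManifolds.isSmoothEmbedding_of_injective_of_injective_mfderiv hc
    (by exact_mod_cast le_top) hinj fun v => ?_
  have h1 : MDifferentiableAt (𝓡 3) (𝓡 4)
      (Subtype.val : Metric.sphere (0 : EuclideanSpace ℝ (Fin 4)) 1 → EuclideanSpace ℝ (Fin 4)) v :=
    (contMDiff_coe_sphere (m := ∞) v).mdifferentiableAt (by simp)
  have h2 : MDifferentiableAt (𝓡 4) (𝓡 4) e (v : EuclideanSpace ℝ (Fin 4)) :=
    (he.contMDiff _).mdifferentiableAt (by simp)
  rw [mfderiv_comp v h2 h1]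
  exact (Literature.Topology.FourManifolds.injective_mfderiv_of_isImmersionAt'
    (he.isImmersion.isImmersionAt _)).comp (mfderiv_coe_sphere_injective (n := 3) v)

/-- **The boundary of an embedded compact 4-manifold with boundary is an embedded closed
3-manifold.**  If `j : Δ → M` is a smooth embedding of a compact 4-manifold with boundary into a
Hausdorff smooth 4-manifold and `b` is a boundary datum of `Δ` (`∂Δ` as an abstract smooth
3-manifold with its embedding `b.incl`, `range b.incl = ∂Δ`), then `j ∘ b.incl : b.carrier → M` is
a smooth embedding: `b.carrier` is compact (homeomorphic to the closed subset `∂Δ` of the compact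
`Δ`, Mathlib `ModelWithCorners.isClosed_boundary`), the composite is smooth and injective, and its
differential is injective by the chain rule (the differential of an immersion is injective also at
boundary points, `injective_mfderiv_of_isImmersionAt'`). -/
theorem isSmoothEmbedding_comp_boundaryData_incl {M : Type*} [TopologicalSpace M] [T2Space M]
    [ChartedSpace (EuclideanSpace ℝ (Fin 4)) M] [IsManifold (𝓡 4) ∞ M]
    {Δ : Type} [TopologicalSpace Δ] [ChartedSpace (EuclideanHalfSpace 4) Δ]
    [IsManifold (𝓡∂ 4) ∞ Δ] [CompactSpace Δ]
    (b : Literature.Topology.FourManifolds.BoundaryData (𝓡∂ 4) Δ (𝓡 3))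
    {j : Δ → M} (hj : Manifold.IsSmoothEmbedding (𝓡∂ 4) (𝓡 4) ∞ j) :
    Manifold.IsSmoothEmbedding (𝓡 3) (𝓡 4) ∞ (j ∘ b.incl) := by
  haveI : CompactSpace b.carrier := by
    refine Topology.IsClosedEmbedding.compactSpace (f := b.incl) ⟨b.isSmoothEmbedding.isEmbedding, ?_⟩
    rw [b.range_incl]
    exact (𝓡∂ 4).isClosed_boundary (M := Δ) (n := ∞) (by simp)
  have hc : ContMDiff (𝓡 3) (𝓡 4) ∞ (j ∘ b.incl) :=
    hj.contMDiff.comp b.isSmoothEmbedding.contMDiff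
  have hinj : Injective (j ∘ b.incl) :=
    hj.isEmbedding.injective.comp b.isSmoothEmbedding.isEmbedding.injective
  refine Literature.Topology.FourManifolds.isSmoothEmbedding_of_injective_of_injective_mfderiv hc
    (by exact_mod_cast le_top) hinj fun x => ?_
  have h1 : MDifferentiableAt (𝓡 3) (𝓡∂ 4) b.incl x :=
    (b.isSmoothEmbedding.contMDiff x).mdifferentiableAt (by simp)
  have h2 : MDifferentiableAt (𝓡∂ 4) (𝓡 4) j (b.incl x) :=
    (hj.contMDiff _).mdifferentiableAt (by simp)
  rw [mfderiv_comp x h2 h1]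
  exact (Literature.Topology.FourManifolds.injective_mfderiv_of_isImmersionAt'
    (hj.isImmersion.isImmersionAt _)).comp
    (Literature.Topology.FourManifolds.injective_mfderiv_of_isImmersionAt'
      (b.isSmoothEmbedding.isImmersion.isImmersionAt x))

/-- **Stub `stub_certifiedFakeBallStandard` (certified fake ball ⇒ standard)**, VERBATIM the
registered stub of line `bennequin-defect-certificates`.  Under E2
(`Gompf1998_thm13_twoHandles`), EL (`Eliashberg1990_steinFilling_sphere_three`) and Cerf's
`Γ₄ = 0` in twisted-sphere form (the three antecedents), a homotopy 4-sphere `S` with a fake ball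
`Δ = S ∖ e(B̊⁴)` (`e`, `j` smooth embeddings, `range j = (e B̊⁴)ᶜ`, `j(∂Δ) = e(S³)`) presented as
`W₀ ∪` 2-handles attached along `T`-Legendrian knots of twisting `-1` (`T` a Stein structure on
`W₀`) is diffeomorphic to `S⁴`: (1) `Δ` is Stein by E2; (2) `∂Δ ≅ S³` because `j ∘ b.incl` and
`e|S³` are smooth embeddings into `S` with the same range; (3) `Δ ≅ 𝔻⁴` by EL; (4) `S` is covered
by the two closed discs `j ∘ Ψ⁻¹` and `e|𝔻⁴` meeting exactly along the common boundary sphere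
`e(S³)`, hence a twisted sphere `𝔻⁴ ∪_φ 𝔻⁴` (`SchoenfliesTools.exists_isTwistedSphere`); (5) Cerf.
Gompf 1998 Thm. 1.3; Akbulut–Matveyev 1998 §3; Eliashberg 1990 Thm. 5.1; Kervaire–Milnor 1963 §1;
Milnor 1965 §9; Cerf 1968. -/
theorem stub_certifiedFakeBallStandard :
    Literature.Geometry.Symplectic.Gompf1998_thm13_twoHandles →
    Literature.Geometry.Symplectic.Eliashberg1990_steinFilling_sphere_three →
    (∀ [Fact (Literature.Topology.FourManifolds.isSmoothEmbedding_sphereInclusion' 3)] (φ : (Metric.sphere (0 : EuclideanSpace ℝ (Fin 4)) 1) ≃ₘ⟮𝓡 3, 𝓡 3⟯ (Metric.sphere (0 : EuclideanSpace ℝ (Fin 4)) 1)) (T : Literature.Topology.FourManifolds.TwistedSphere 3 φ), Nonempty (T.carrier ≃ₘ⟮𝓡 4, 𝓡 4⟯ Metric.sphere (0 : EuclideanSpace ℝ (Fin 5)) 1)) →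
    ∀ (S : Literature.Topology.FourManifolds.HomotopySphere 4) (e : EuclideanSpace ℝ (Fin 4) → S.carrier)
      (Δ : Type) [TopologicalSpace Δ] [T2Space Δ] [SecondCountableTopology Δ]
      [ChartedSpace (EuclideanHalfSpace 4) Δ] [IsManifold (𝓡∂ 4) ∞ Δ] [CompactSpace Δ] (j : Δ → S.carrier)
      (W₀ : Type) [TopologicalSpace W₀] [T2Space W₀] [SecondCountableTopology W₀]
      [ChartedSpace (EuclideanHalfSpace 4) W₀] [IsManifold (𝓡∂ 4) ∞ W₀] [CompactSpace W₀]
      (T : Literature.Geometry.Symplectic.SteinStructure W₀)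
      (ι : Type) [Finite ι] (h : ι → Literature.Topology.FourManifolds.HandleAttachingMap 3 2 W₀),
      (Manifold.IsSmoothEmbedding (𝓡 4) (𝓡 4) ∞ e ∧ Manifold.IsSmoothEmbedding (𝓡∂ 4) (𝓡 4) ∞ j ∧
          Set.range j = (e '' Metric.ball (0 : EuclideanSpace ℝ (Fin 4)) 1)ᶜ ∧
          j '' ((𝓡∂ 4).boundary Δ) = e '' Metric.sphere (0 : EuclideanSpace ℝ (Fin 4)) 1) →
      Literature.Topology.FourManifolds.HandleAttachingMap.IsMultiAttachment h (𝓡∂ 4) Δ →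
      (∀ i, Literature.Geometry.Symplectic.IsLegendrianKnot T.J (h i).attachingCircle) →
      (∀ i, T.twisting (h i).attachingCircle (h i).attachingFraming = -1) →
      Nonempty (S.carrier ≃ₘ⟮𝓡 4, 𝓡 4⟯ Metric.sphere (0 : EuclideanSpace ℝ (Fin 5)) 1) := by
  intro hE2 hEL hCerf S e Δ _ _ _ _ _ _ j W₀ _ _ _ _ _ _ T ι _ h he hmulti hLeg htw
  obtain ⟨he, hj, hrange, hbdry⟩ := he
  -- (1) the fake ball is a Stein domain (E2)
  have hStein : Literature.Geometry.Symplectic.IsSteinDomain Δ := hE2 W₀ Δ T ι h hmulti hLeg htw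
  -- (2) its boundary is diffeomorphic to `S³`
  obtain ⟨b⟩ : Nonempty (Literature.Topology.FourManifolds.BoundaryData (𝓡∂ 4) Δ (𝓡 3)) :=
    Literature.Topology.FourManifolds.nonempty_boundaryData_holds 3 Δ
  have hκ₁ := isSmoothEmbedding_comp_boundaryData_incl b hj
  have hκ₂ := isSmoothEmbedding_comp_coe_sphere he
  have hrange_eq : range (j ∘ b.incl) =
      range (e ∘ Subtype.val : Metric.sphere (0 : EuclideanSpace ℝ (Fin 4)) 1 → S.carrier) := by
    rw [range_comp, b.range_incl, hbdry, range_comp, Subtype.range_coe]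
  obtain ⟨Φ, -⟩ :=
    Literature.Geometry.Manifold.exists_diffeomorph_comp_eq_of_range_eq hκ₁ hκ₂ hrange_eq
  -- (3) the fake ball is the standard ball (EL)
  obtain ⟨Ψ⟩ := hEL Δ hStein ⟨b, ⟨Φ⟩⟩
  -- (4) the two closed discs `j ∘ Ψ⁻¹` and `e|𝔻⁴`
  have hA : Manifold.IsSmoothEmbedding (𝓡∂ 4) (𝓡 4) ∞ (j ∘ Ψ.symm) := hj.comp_diffeomorph Ψ.symm
  have hEloc := he.isLocalDiffeomorph_of_finrank_eq rfl
  have hB := Literature.Topology.FourManifolds.isSmoothEmbedding_comp_coe_closedBall_of_injective_mfderiv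
    (n := 3) (m := 4) he.contMDiff he.isEmbedding.injective.injOn (fun y _ a b hab =>
      ((hEloc y).mfderivToContinuousLinearEquiv (by simp)).injective hab)
  -- boundary points of `𝔻⁴` correspond under `Ψ⁻¹` to boundary points of `Δ`
  have hbd4 : (𝓡∂ 4).boundary (Metric.closedBall (0 : EuclideanSpace ℝ (Fin 4)) 1) =
      {x : Metric.closedBall (0 : EuclideanSpace ℝ (Fin 4)) 1 | ‖(x : EuclideanSpace ℝ (Fin 4))‖ = 1} :=
    Literature.Topology.FourManifolds.boundary_closedBall 3
  have hΨbd : ∀ a : Metric.closedBall (0 : EuclideanSpace ℝ (Fin 4)) 1,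
      Ψ.symm a ∈ (𝓡∂ 4).boundary Δ ↔ ‖(a : EuclideanSpace ℝ (Fin 4))‖ = 1 := by
    intro a
    have h1 : a ∈ Ψ.symm ⁻¹' (𝓡∂ 4).boundary Δ ↔
        a ∈ (𝓡∂ 4).boundary (Metric.closedBall (0 : EuclideanSpace ℝ (Fin 4)) 1) := by
      rw [Ψ.symm.preimage_boundary (by simp)]
    rw [mem_preimage] at h1
    rw [h1, hbd4, mem_setOf_eq]
  have hrangeA : range (j ∘ Ψ.symm) = (e '' Metric.ball (0 : EuclideanSpace ℝ (Fin 4)) 1)ᶜ := by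
    rw [(EquivLike.surjective Ψ.symm).range_comp, hrange]
  -- (5) `S = 𝔻⁴ ∪_φ 𝔻⁴` is a twisted sphere, hence `S⁴` by Cerf's `Γ₄ = 0`
  refine (Literature.Topology.FourManifolds.SchoenfliesTools.exists_isTwistedSphere
    (n := 3) hA hB ?_ ?_ ?_).elim fun φ hφ => hCerf φ ⟨S.carrier, hφ⟩
  · -- the two discs cover `S`
    apply eq_univ_of_forall
    intro x
    by_cases hx : x ∈ e '' Metric.ball (0 : EuclideanSpace ℝ (Fin 4)) 1
    · obtain ⟨a, ha, rfl⟩ := hx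
      exact Or.inr ⟨⟨a, ball_subset_closedBall ha⟩, rfl⟩
    · left
      rw [hrangeA]
      exact hx
  · -- they meet along boundary points only
    intro a b' hab
    change j (Ψ.symm a) = e b' at hab
    have hmem : j (Ψ.symm a) ∈ (e '' Metric.ball (0 : EuclideanSpace ℝ (Fin 4)) 1)ᶜ :=
      hrange ▸ mem_range_self _
    have hb1 : ‖(b' : EuclideanSpace ℝ (Fin 4))‖ = 1 := by
      have hnot : e b' ∉ e '' Metric.ball (0 : EuclideanSpace ℝ (Fin 4)) 1 := hab ▸ hmem
      have hnlt : ¬ ‖(b' : EuclideanSpace ℝ (Fin 4))‖ < 1 := fun hlt =>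
        hnot ⟨b', mem_ball_zero_iff.2 hlt, rfl⟩
      exact le_antisymm (mem_closedBall_zero_iff.1 b'.2) (not_lt.1 hnlt)
    refine ⟨?_, hb1⟩
    have hsph : e b' ∈ e '' Metric.sphere (0 : EuclideanSpace ℝ (Fin 4)) 1 :=
      ⟨b', mem_sphere_zero_iff_norm.2 hb1, rfl⟩
    rw [← hbdry, ← hab] at hsph
    obtain ⟨d, hd, hjd⟩ := hsph
    have hda : d = Ψ.symm a := hj.isEmbedding.injective hjd
    rw [← hΨbd a, ← hda]
    exact hd
  · -- the boundary spheres agree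
    have hR : range ((e ∘ Subtype.val : Metric.closedBall (0 : EuclideanSpace ℝ (Fin 4)) 1 →
        S.carrier) ∘ Set.inclusion sphere_subset_closedBall) =
        e '' Metric.sphere (0 : EuclideanSpace ℝ (Fin 4)) 1 := by
      ext x
      constructor
      · rintro ⟨z, rfl⟩
        exact ⟨z, z.2, rfl⟩
      · rintro ⟨w, hw, rfl⟩
        exact ⟨⟨w, hw⟩, rfl⟩
    have hL : range ((j ∘ Ψ.symm) ∘ Set.inclusion (sphere_subset_closedBall :
        Metric.sphere (0 : EuclideanSpace ℝ (Fin 4)) 1 ⊆ Metric.closedBall 0 1)) =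
        j '' ((𝓡∂ 4).boundary Δ) := by
      ext x
      constructor
      · rintro ⟨z, rfl⟩
        refine ⟨Ψ.symm (Set.inclusion sphere_subset_closedBall z), (hΨbd _).2 ?_, rfl⟩
        exact norm_eq_of_mem_sphere z
      · rintro ⟨d, hd, rfl⟩
        have hn1 : ‖((Ψ d : Metric.closedBall (0 : EuclideanSpace ℝ (Fin 4)) 1) :
            EuclideanSpace ℝ (Fin 4))‖ = 1 :=
          (hΨbd (Ψ d)).1 (by rw [Diffeomorph.symm_apply_apply]; exact hd)
        refine ⟨⟨((Ψ d : Metric.closedBall (0 : EuclideanSpace ℝ (Fin 4)) 1) :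
            EuclideanSpace ℝ (Fin 4)), mem_sphere_zero_iff_norm.2 hn1⟩, ?_⟩
        have hincl : Set.inclusion sphere_subset_closedBall
            ⟨((Ψ d : Metric.closedBall (0 : EuclideanSpace ℝ (Fin 4)) 1) :
              EuclideanSpace ℝ (Fin 4)), mem_sphere_zero_iff_norm.2 hn1⟩ = Ψ d :=
          Subtype.ext rfl
        show j (Ψ.symm (Set.inclusion sphere_subset_closedBall _)) = j d
        rw [hincl, Diffeomorph.symm_apply_apply]
    rw [hL, hR, hbdry]

end Summit.SmoothPoincare4.SmoothPoincare4.Theorems.OrigamiFoldExistence.BennequinDefectCertificates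

end
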